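import Literature.MathematicalPhysics.QuantumFieldTheory.Balaban1983to89.T4GoodClassBudget
import Literature.MathematicalPhysics.QuantumFieldTheory.Balaban1983to89.T4CouplingMatching

/-!
# `Balaban1983to89.T4TowerRateComposition` — TERM-WISE MATCHING ALONG THE TOWER: the rates of nodes U1–U3 (cell
NE2/NE3/NE5/NE9, node U2's coupling matching) COMPOSED over the `K` steps with `K`-UNIFORM constants, and the summability
`Σ_K δ_K < ∞` from the geometric factors (cell `pub-balaban`, T4-DAG §5 node U5 / estimate NE7, technique "term-wise";
kernel bookkeeping over `T4OutputRate`, `T4RecentScale`, `T4Crossover`, `T4GoodClassBudget`, `T4CouplingMatching`;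
record `t4/T4-EST-NE7-P1.md`)

HONEST FRAMING (cell `pub-balaban`, T4-DAG PAGE 1).  The cell's T4 target is the existence AND uniqueness of the continuum
limit of Bałaban's unit-scale averaged loop expectations on a FINITE torus, rung (B)+1 of the cell's ladder — strictly
beyond ultraviolet stability ([Balaban1989LargeFieldII] Thm 1 p. 355); it is NOT infinite volume, NOT the Yang–Mills mass
gap and NOT the Clay problem.  Estimate NE7 (matching of the two runs' dressed partition functions MODULO CONSTANTS with a
summable radius) is NOT PRINTED anywhere; this module does NOT prove it.  What is kernel-checked here is the real-number
COMPOSITION step of the term-wise technique, decl by decl: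
* §1 rate algebra along the tower: discrete convolutions of two geometric rates (`Σ_{i<j} ω^{j−i}θ^i ≤ ω/(θ−ω)·θ^j` for
  `ω < θ`, `≤ j·max(ω,θ)^j` always), absorption of polynomial factors into a slightly worse rate
  (`(n+1)^q m^n ≤ M·θ'^n` for `m < θ'`), boundedness of `(n+1)^q m^n` for `m < 1`;
* §2 the COUPLING BRACKET AT RATE: fading memory of the history moduli (`T4OutputRate.FadingMemory`, NOT PRINTED) composed
  with node U2's coupling matching AT RATE `|g^A_i − g^B_i| ≤ Dθ^i` gives the history sum `≤ C₉D·ω/(θ−ω)·θ^j` UNIFORMLY IN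
  THE NUMBER OF STEPS (the tree had only the uniform-discrepancy version `T4OutputRate.historySum_le_of_fadingMemory`, which
  loses the rate); and the conversion of node U2's typed output (`T4CauchySum.InjectedRate … disc`, discrepancy of INVERSE
  SQUARED couplings) into the coupling discrepancy itself on the printed box `0 < g ≤ γ`;
* §3 the ARGUMENT BRACKET AT RATE: a Lipschitz-in-the-background constant allowed to grow polynomially in the number of
  REMAINING scales `K − j` (hypothesis shape; what `α_{·,j}`-shrinking domains suggest, NOT PRINTED) times the
  `θ₃^K`-closeness of the two runs' final background fields (node U1b/NE3 in consumer shape, `K` = number of steps) is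
  `≤ a·θ^j` with `a` INDEPENDENT OF `K` (`θ₃ ≤ θ`): the factor `θ₃^{K−j}` absorbs the growth;
* §4 the three brackets composed along the tower: for EVERY cutoff `K` the node-U3 rate `URateUpTo K` on all domains of
  scale `≤ K` with ONE constant `a + C₉Dω/(θ−ω) + C₅` (separated rates) or `a + C₉D(K+1) + C₅` (equal rates), the
  instance of the node-U5b statement for the small-field kind on ledgers of scale `≤ K`, and the observation that the
  FIELD-INDEPENDENT constants of that instance are themselves rate-small when the transport maps run B's trivial background
  to run A's (input to hazard H-U5b-1 of `T4GoodClassBudget.RecentDeviation`);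
* §5 summability with POLYNOMIALLY GROWING rate constants: the crossover majorant of `T4Crossover` with rate constant
  `C·(K+1)^p` at cutoff `K` (`crossoverDeltaPoly`) is still summable over `K` under the SAME hypotheses (`κ₀ > 4`, lower half
  of (0.31), `θ(Λ/θ)^σ < 1` chosen by `T4Crossover.exists_recentRate_lt_one`) — so neither the equal-rate case of §4 nor a
  polynomial argument-bracket growth endangers `Σ_K δ_K < ∞`; only the GEOMETRIC factors matter;
* §7 NON-VACUITY: a toy family of functionals meeting NE9 + fading memory + Lipschitz-in-U + NE5 simultaneously with a
  non-zero rate (the hypothesis set of §4 is jointly satisfiable and its conclusion not vacuous);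
* §6 the plug: per-slice SIZE radii of the printed all-regular shapes ((2.43)/(2.44) with `n = k`) and RATE radii from
  multiplicity × the composed rate give the per-term radius `≤ vol·max(Cw,1)·crossoverDeltaPoly … K`, and a
  `T4GoodClassBudget.TermBudget` with that remainder profile yields the `hgood` clause `GoodClause` TOGETHER WITH the
  `Summable δ` input of `T4GoodClassBudget.cauchy_of_goodClause` / `T4HybridMatching.cauchy_of_hybrid`.
Every cell estimate enters as a HYPOTHESIS (NE9/`LipBackground`/NE5 of `T4OutputRate`, fading memory, the coupling rate,
the closeness `δc K`, the polynomial Lipschitz growth, multiplicity, the size radii, the `TermBudget` fields), never as a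
fact; no conditional ((B), (B^μ), BetaPertH) is hidden in a definition — none is even needed at this level of abstraction,
they enter UPSTREAM, in whatever verifies the hypothesis shapes for Bałaban's expansions (nobody has; cell GAPS G-t4-U3-1…3,
G-t4-U2-2, G-t4-U5-NE7).

CITATION HEADER (printed context only; quotations as transcribed in the cell's XREAD records and in the headers of the
imported tree modules `T4OutputRate`, `T4RecentScale`, `T4GoodClassBudget`, `T4CouplingMatching`, which read them from the
cell's page store).
* [Balaban1987RG1] T. Bałaban, *Renormalization group approach to lattice gauge field theories. I*, Commun. Math. Phys. 109
  (1987) 249–301: Theorem 1 p. 259 with «the above bound is uniform in the lattice spacing ε» (ONE run; uniformity, no rate);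
  p. 263 «It is a C^∞-function of g_{j−1} ∈ [0, γ], (or analytic)» (dependence on the LAST coupling, qualitative); (0.26)
  p. 257 (sums over localization domains through a cube — the multiplicity count); (0.31) p. 258 (the two-sided discrete
  flow `1/g² + b(K−k) ≤ 1/g_k² ≤ 1/g² + β′(K−k)`, tree `Step.Discrete031`).
* [Balaban1988Convergent] T. Bałaban, *Convergent renormalization expansions for lattice gauge theories*, Commun. Math. Phys.
  119 (1988) 243–285: (2.27)–(2.28) p. 259 (analyticity domains `U^c_j(X, α_{0,j}, α_{1,j})`, `α_{·,j} = g_jC(log g_j^{−2})^q`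
  — the printed reason a Lipschitz-in-U constant may depend on the scale); Theorem 2 (2.43)–(2.44) p. 263 (the SIZE bounds,
  with large-field volumes `|Γ_n ∩ Ω|`; only the all-regular part `n = k` is the size branch used in §6).
* [GawedzkiKupiainen1985] K. Gawędzki, A. Kupiainen, *Massless lattice φ⁴₄ theory: rigorous control of a renormalizable
  asymptotically free model*, Commun. Math. Phys. 99 (1985) 197–252: (142)–(143) p. 20 of the cell's copy — the MARGINAL
  direction does not contract («Thus the initial δg_Λ has to be smaller than, say, 𝒪(g_Λ^{3+ε})»): the printed reason the
  coupling bracket needs node U2's RATE `θ^i` and not merely a uniform discrepancy (§2; why-it-might-fail (4) of node U5).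
* [King1986] C. King, *The U(1) Higgs model. II*, Commun. Math. Phys. 103 (1986) 323–349: (3.73) p. 665 of the cell's copy,
  the printed MODEL of a scale-covariant rate `L^{−γk}` (convention of `T4EtaRate.rateFactor`, inherited through NE5).

WHAT IS PROVED is [folklore] throughout (finite geometric sums, `exp`/`log`-free real inequalities, comparison of series);
WHAT IS ONLY TYPED: `URateUpTo` (node U3 along the V-family up to cutoff `K`), `PolyLipGrowth` (§3), `crossoverDeltaPoly`
(§5).  Deliberately NOT here: the weight half of NE7 (sibling seat, `T4WeightBudget.RelWeightBound`), the D-term /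
observable bookkeeping (`T4TermFormat`), the deviation of the term constants from a class constant (hazard H-U5b-1,
`T4GoodClassBudget.RecentDeviation` — §4 only shows its per-domain input is rate-small), and any claim that Bałaban's
expansions satisfy the hypothesis shapes.
-/

open Finset

namespace Literature.MathematicalPhysics.QuantumFieldTheory.Balaban1983to89.T4TowerRateComposition

open T4OutputRate T4RecentScale T4GoodClassBudget T4Crossover T4CauchySum

/-! ## §1 Rate algebra along the tower (kernel-checked) -/

/-- `(n+1)·x^n ≤ (1 − x)⁻¹` for `0 ≤ x < 1` (each of the `n+1` terms `x^k`, `k ≤ n`, of the geometric series dominates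
`x^n`; the partial sums are below the full sum `(1 − x)⁻¹`, `hasSum_geometric_of_lt_one`). [folklore] -/
theorem succ_mul_pow_le {x : ℝ} (hx0 : 0 ≤ x) (hx1 : x < 1) (n : ℕ) :
    ((n : ℝ) + 1) * x ^ n ≤ (1 - x)⁻¹ := by
  have h1 : ((n : ℝ) + 1) * x ^ n ≤ ∑ k ∈ range (n + 1), x ^ k := by
    have hk : ∀ k ∈ range (n + 1), x ^ n ≤ x ^ k := fun k hk =>
      pow_le_pow_of_le_one hx0 hx1.le (Nat.le_of_lt_succ (mem_range.mp hk))
    calc ((n : ℝ) + 1) * x ^ n = ∑ k ∈ range (n + 1), x ^ n := by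
          rw [sum_const, card_range, nsmul_eq_mul]; push_cast; ring
      _ ≤ ∑ k ∈ range (n + 1), x ^ k := sum_le_sum hk
  exact h1.trans (sum_le_hasSum _ (fun k _ => pow_nonneg hx0 k) (hasSum_geometric_of_lt_one hx0 hx1))

/-- ABSORPTION OF A LINEAR FACTOR INTO A WORSE RATE: `(n+1)·m^n ≤ θ'/(θ' − m)·θ'^n` for `0 ≤ m < θ'`. [folklore] -/
theorem succ_mul_pow_le_geom {m θ' : ℝ} (hm : 0 ≤ m) (hmθ : m < θ') (n : ℕ) :
    ((n : ℝ) + 1) * m ^ n ≤ θ' / (θ' - m) * θ' ^ n := by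
  have hθ' : 0 < θ' := hm.trans_lt hmθ
  have hθne : θ' ≠ 0 := hθ'.ne'
  have hx0 : 0 ≤ m / θ' := div_nonneg hm hθ'.le
  have hx1 : m / θ' < 1 := (div_lt_one hθ').mpr hmθ
  have h := succ_mul_pow_le hx0 hx1 n
  rw [one_sub_div hθne, inv_div, div_pow] at h
  have hne : θ' ^ n ≠ 0 := pow_ne_zero _ hθne
  have key : ((n : ℝ) + 1) * (m ^ n / θ' ^ n) * θ' ^ n = ((n : ℝ) + 1) * m ^ n := by
    field_simp
  rw [← key]
  exact mul_le_mul_of_nonneg_right h (pow_nonneg hθ'.le n)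

/-- ABSORPTION OF A POLYNOMIAL FACTOR: for `0 ≤ m < θ'` and every `q` there is `M ≥ 0` with `(n+1)^q m^n ≤ M·θ'^n` for
all `n` (induction on `q` through the midpoint rate `(m + θ')/2`). [folklore] -/
theorem succ_pow_mul_pow_le_geom (q : ℕ) :
    ∀ {m θ' : ℝ}, 0 ≤ m → m < θ' → ∃ M : ℝ, 0 ≤ M ∧ ∀ n : ℕ, ((n : ℝ) + 1) ^ q * m ^ n ≤ M * θ' ^ n := by
  induction q with
  | zero =>
    intro m θ' hm hmθ
    exact ⟨1, zero_le_one, fun n => by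
      rw [pow_zero, one_mul, one_mul]; exact pow_le_pow_left₀ hm hmθ.le n⟩
  | succ q ih =>
    intro m θ' hm hmθ
    have h1 : m < (m + θ') / 2 := by linarith
    have h2 : (m + θ') / 2 < θ' := by linarith
    have hm' : 0 ≤ (m + θ') / 2 := by linarith
    obtain ⟨M, hM0, hM⟩ := ih hm h1
    refine ⟨M * (θ' / (θ' - (m + θ') / 2)),
      mul_nonneg hM0 (div_nonneg (by linarith) (by linarith)), fun n => ?_⟩
    have hs := succ_mul_pow_le_geom hm' h2 n
    calc ((n : ℝ) + 1) ^ (q + 1) * m ^ n = ((n : ℝ) + 1) * (((n : ℝ) + 1) ^ q * m ^ n) := by ring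
      _ ≤ ((n : ℝ) + 1) * (M * ((m + θ') / 2) ^ n) := mul_le_mul_of_nonneg_left (hM n) (by positivity)
      _ = M * (((n : ℝ) + 1) * ((m + θ') / 2) ^ n) := by ring
      _ ≤ M * (θ' / (θ' - (m + θ') / 2) * θ' ^ n) := mul_le_mul_of_nonneg_left hs hM0
      _ = M * (θ' / (θ' - (m + θ') / 2)) * θ' ^ n := by ring

/-- BOUNDEDNESS: for `0 ≤ m < 1`, `(n+1)^q m^n ≤ M` for all `n` (the case `θ' = 1`). [folklore] -/
theorem exists_bound_succ_pow_mul_pow {m : ℝ} (hm : 0 ≤ m) (hm1 : m < 1) (q : ℕ) :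
    ∃ M : ℝ, 0 ≤ M ∧ ∀ n : ℕ, ((n : ℝ) + 1) ^ q * m ^ n ≤ M := by
  obtain ⟨M, hM0, hM⟩ := succ_pow_mul_pow_le_geom q hm hm1
  exact ⟨M, hM0, fun n => by simpa using hM n⟩

/-- DISCRETE CONVOLUTION OF TWO RATES, GENERAL: `Σ_{i<j} ω^{j−i} θ^i ≤ j·max(ω,θ)^j` (`0 ≤ ω, θ`). [folklore] -/
theorem conv_le_mul_max_pow {ω θ : ℝ} (hω : 0 ≤ ω) (hθ : 0 ≤ θ) (j : ℕ) :
    ∑ i ∈ range j, ω ^ (j - i) * θ ^ i ≤ (j : ℝ) * (max ω θ) ^ j := by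
  have hterm : ∀ i ∈ range j, ω ^ (j - i) * θ ^ i ≤ (max ω θ) ^ j := by
    intro i hi
    have hij : i ≤ j := (mem_range.mp hi).le
    calc ω ^ (j - i) * θ ^ i ≤ (max ω θ) ^ (j - i) * (max ω θ) ^ i :=
          mul_le_mul (pow_le_pow_left₀ hω (le_max_left _ _) _) (pow_le_pow_left₀ hθ (le_max_right _ _) _)
            (pow_nonneg hθ _) (pow_nonneg (hω.trans (le_max_left _ _)) _)
      _ = (max ω θ) ^ j := by rw [← pow_add, Nat.sub_add_cancel hij]
  calc ∑ i ∈ range j, ω ^ (j - i) * θ ^ i ≤ ∑ i ∈ range j, (max ω θ) ^ j := sum_le_sum hterm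
    _ = (j : ℝ) * (max ω θ) ^ j := by rw [sum_const, card_range, nsmul_eq_mul]

/-- DISCRETE CONVOLUTION OF TWO SEPARATED RATES: for `0 ≤ ω < θ`, `Σ_{i<j} ω^{j−i} θ^i ≤ ω/(θ − ω)·θ^j` — the faster
rate is absorbed, UNIFORMLY IN `j`. [folklore] -/
theorem conv_le_of_lt {ω θ : ℝ} (hω : 0 ≤ ω) (hωθ : ω < θ) (j : ℕ) :
    ∑ i ∈ range j, ω ^ (j - i) * θ ^ i ≤ ω / (θ - ω) * θ ^ j := by
  have hθ : 0 < θ := hω.trans_lt hωθ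
  have hθne : θ ≠ 0 := hθ.ne'
  have hx0 : 0 ≤ ω / θ := div_nonneg hω hθ.le
  have hx1 : ω / θ < 1 := (div_lt_one hθ).mpr hωθ
  have hterm : ∀ i ∈ range j, ω ^ (j - i) * θ ^ i = θ ^ j * (ω / θ) ^ (j - i) := by
    intro i hi
    have hij : i ≤ j := (mem_range.mp hi).le
    have hθj : θ ^ j = θ ^ (j - i) * θ ^ i := by rw [← pow_add, Nat.sub_add_cancel hij]
    rw [hθj, div_pow]
    have hne : θ ^ (j - i) ≠ 0 := pow_ne_zero _ hθne
    field_simp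
  have hrefl : ∑ i ∈ range j, (ω / θ) ^ (j - i) = ∑ m ∈ range j, (ω / θ) ^ (m + 1) := by
    rw [← sum_range_reflect (fun m => (ω / θ) ^ (m + 1)) j]
    refine sum_congr rfl fun i hi => ?_
    rw [mem_range] at hi
    congr 1
    omega
  have htail : ∑ m ∈ range j, (ω / θ) ^ (m + 1) ≤ ω / θ * (1 - ω / θ)⁻¹ := by
    have e : ∑ m ∈ range j, (ω / θ) ^ (m + 1) = ω / θ * ∑ m ∈ range j, (ω / θ) ^ m := by
      rw [mul_sum]; exact sum_congr rfl fun m _ => by ring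
    rw [e]
    exact mul_le_mul_of_nonneg_left
      (sum_le_hasSum _ (fun k _ => pow_nonneg hx0 k) (hasSum_geometric_of_lt_one hx0 hx1)) hx0
  have hid : ω / θ * (1 - ω / θ)⁻¹ = ω / (θ - ω) := by
    rw [one_sub_div hθne, inv_div]
    have hne : θ - ω ≠ 0 := sub_ne_zero.mpr hωθ.ne'
    field_simp
  calc ∑ i ∈ range j, ω ^ (j - i) * θ ^ i = ∑ i ∈ range j, θ ^ j * (ω / θ) ^ (j - i) := sum_congr rfl hterm
    _ = θ ^ j * ∑ m ∈ range j, (ω / θ) ^ (m + 1) := by rw [← mul_sum, hrefl]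
    _ ≤ θ ^ j * (ω / θ * (1 - ω / θ)⁻¹) := mul_le_mul_of_nonneg_left htail (pow_nonneg hθ.le j)
    _ = ω / (θ - ω) * θ ^ j := by rw [hid, mul_comm]

/-! ## §2 The coupling bracket AT RATE (node U2 ⊛ fading memory) -/

/-- The fading-memory constant is nonnegative (read off at `k = i = 0`). [folklore] -/
theorem fadingMemory_const_nonneg {C₉ ω : ℝ} {Λ : ℕ → ℕ → ℝ} (hΛ : FadingMemory C₉ ω Λ) : 0 ≤ C₉ := by
  have h00 := hΛ 0 0 le_rfl
  have := h00.1.trans h00.2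
  simpa using this

/-- **COUPLING BRACKET AT RATE, SEPARATED RATES.**  Fading memory `Λ j i ≤ C₉ω^{j−i}` (NOT PRINTED) and node U2's coupling
matching AT RATE `|g^A_i − g^B_i| ≤ D·θ^i` for `i < j`, with `0 ≤ ω < θ`, give the history sum of `T4OutputRate.NE9`
bounded by `C₉·D·ω/(θ−ω)·θ^j` — a `θ^j`-rate with a constant INDEPENDENT OF `j` and of the number of steps.  This is the
`hb` input of `T4OutputRate.u3_geometric` / `T4RecentScale.uRate_of_u3`. [folklore] -/
theorem historySum_le_rate {C₉ ω θ D : ℝ} {Λ : ℕ → ℕ → ℝ} (hΛ : FadingMemory C₉ ω Λ) (hω : 0 ≤ ω)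
    (hωθ : ω < θ) (hD : 0 ≤ D) {gA gB : ℕ → ℝ} {j : ℕ} (he : ∀ i < j, |gA i - gB i| ≤ D * θ ^ i) :
    ∑ i ∈ range j, Λ j i * |gA i - gB i| ≤ C₉ * D * (ω / (θ - ω)) * θ ^ j := by
  have hC9 := fadingMemory_const_nonneg hΛ
  have step : ∀ i ∈ range j, Λ j i * |gA i - gB i| ≤ C₉ * D * (ω ^ (j - i) * θ ^ i) := by
    intro i hi
    have hij := mem_range.mp hi
    obtain ⟨h0, h1⟩ := hΛ j i hij.le
    calc Λ j i * |gA i - gB i| ≤ (C₉ * ω ^ (j - i)) * (D * θ ^ i) :=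
          mul_le_mul h1 (he i hij) (abs_nonneg _) (h0.trans h1)
      _ = C₉ * D * (ω ^ (j - i) * θ ^ i) := by ring
  calc ∑ i ∈ range j, Λ j i * |gA i - gB i| ≤ ∑ i ∈ range j, C₉ * D * (ω ^ (j - i) * θ ^ i) := sum_le_sum step
    _ = C₉ * D * ∑ i ∈ range j, ω ^ (j - i) * θ ^ i := by rw [mul_sum]
    _ ≤ C₉ * D * (ω / (θ - ω) * θ ^ j) :=
        mul_le_mul_of_nonneg_left (conv_le_of_lt hω hωθ j) (mul_nonneg hC9 hD)
    _ = C₉ * D * (ω / (θ - ω)) * θ ^ j := by ring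

/-- COUPLING BRACKET AT RATE, GENERAL: `≤ C₉·D·j·max(ω,θ)^j` (a factor `j` appears when the two rates are not separated).
[folklore] -/
theorem historySum_le_maxRate {C₉ ω θ D : ℝ} {Λ : ℕ → ℕ → ℝ} (hΛ : FadingMemory C₉ ω Λ) (hω : 0 ≤ ω)
    (hθ : 0 ≤ θ) (hD : 0 ≤ D) {gA gB : ℕ → ℝ} {j : ℕ} (he : ∀ i < j, |gA i - gB i| ≤ D * θ ^ i) :
    ∑ i ∈ range j, Λ j i * |gA i - gB i| ≤ C₉ * D * (j : ℝ) * (max ω θ) ^ j := by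
  have hC9 := fadingMemory_const_nonneg hΛ
  have step : ∀ i ∈ range j, Λ j i * |gA i - gB i| ≤ C₉ * D * (ω ^ (j - i) * θ ^ i) := by
    intro i hi
    have hij := mem_range.mp hi
    obtain ⟨h0, h1⟩ := hΛ j i hij.le
    calc Λ j i * |gA i - gB i| ≤ (C₉ * ω ^ (j - i)) * (D * θ ^ i) :=
          mul_le_mul h1 (he i hij) (abs_nonneg _) (h0.trans h1)
      _ = C₉ * D * (ω ^ (j - i) * θ ^ i) := by ring
  calc ∑ i ∈ range j, Λ j i * |gA i - gB i| ≤ ∑ i ∈ range j, C₉ * D * (ω ^ (j - i) * θ ^ i) := sum_le_sum step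
    _ = C₉ * D * ∑ i ∈ range j, ω ^ (j - i) * θ ^ i := by rw [mul_sum]
    _ ≤ C₉ * D * ((j : ℝ) * (max ω θ) ^ j) :=
        mul_le_mul_of_nonneg_left (conv_le_mul_max_pow hω hθ j) (mul_nonneg hC9 hD)
    _ = C₉ * D * (j : ℝ) * (max ω θ) ^ j := by ring

/-- COUPLING BRACKET AT ANY WORSE RATE: for `θ' > max(ω, θ)` the factor `j` is absorbed, `≤ C₉·D·θ'/(θ' − max(ω,θ))·θ'^j`
(rates can always be worsened; the constant stays independent of `j`). [folklore] -/
theorem historySum_le_rate_of_lt {C₉ ω θ θ' D : ℝ} {Λ : ℕ → ℕ → ℝ} (hΛ : FadingMemory C₉ ω Λ) (hω : 0 ≤ ω)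
    (hθ : 0 ≤ θ) (hD : 0 ≤ D) (hθ' : max ω θ < θ') {gA gB : ℕ → ℝ} {j : ℕ}
    (he : ∀ i < j, |gA i - gB i| ≤ D * θ ^ i) :
    ∑ i ∈ range j, Λ j i * |gA i - gB i| ≤ C₉ * D * (θ' / (θ' - max ω θ)) * θ' ^ j := by
  have hC9D := mul_nonneg (fadingMemory_const_nonneg hΛ) hD
  have hm : 0 ≤ max ω θ := hω.trans (le_max_left _ _)
  have h := historySum_le_maxRate hΛ hω hθ hD he
  have hs := succ_mul_pow_le_geom hm hθ' j
  have hj : (j : ℝ) * (max ω θ) ^ j ≤ ((j : ℝ) + 1) * (max ω θ) ^ j :=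
    mul_le_mul_of_nonneg_right (by linarith) (pow_nonneg hm j)
  calc ∑ i ∈ range j, Λ j i * |gA i - gB i| ≤ C₉ * D * ((j : ℝ) * (max ω θ) ^ j) := by
        simpa [mul_assoc] using h
    _ ≤ C₉ * D * (θ' / (θ' - max ω θ) * θ' ^ j) := mul_le_mul_of_nonneg_left (hj.trans hs) hC9D
    _ = C₉ * D * (θ' / (θ' - max ω θ)) * θ' ^ j := by ring

/-- **NODE U2's TYPED OUTPUT ⇒ THE COUPLING RATE.**  Node U2 delivers the discrepancy of the INVERSE SQUARED re-indexed
couplings, `T4CauchySum.InjectedRate Cd 0 θ (fun K j => disc (g K) (g (K+1)) j)` (tree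
`T4CouplingMatching.injectedRate_of_runs_eventual` under its hypotheses); on the printed box `0 < g ≤ γ` ((0.30) p. 258:
the couplings stay in `(0, γ]`) this is the coupling rate `|g^{(K)}_j − g^{(K+1)}_{j+1}| ≤ γ³·Cd·θ^j` consumed by §2
(`T4CouplingMatching.abs_sub_le_of_inv_sq`). [folklore] -/
theorem couplingRate_of_injectedDisc {Cd θ γ : ℝ} {g : ℕ → ℕ → ℝ}
    (h : InjectedRate Cd 0 θ (fun K j => T4CouplingMatching.disc (g K) (g (K + 1)) j))
    (hbox : ∀ K i, i ≤ K → 0 < g K i ∧ g K i ≤ γ) {K j : ℕ} (hj : j ≤ K) :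
    |g K j - g (K + 1) (j + 1)| ≤ γ ^ 3 * Cd * θ ^ j := by
  have hd := (h K j hj).2
  simp only [T4CouplingMatching.disc, pow_zero, mul_one] at hd
  obtain ⟨ha, haγ⟩ := hbox K j hj
  obtain ⟨hb, hbγ⟩ := hbox (K + 1) (j + 1) (Nat.succ_le_succ hj)
  have hγ : 0 ≤ γ := ha.le.trans haγ
  have h1 := T4CouplingMatching.abs_sub_le_of_inv_sq ha hb
  have hw : g K j ^ 2 * g (K + 1) (j + 1) ≤ γ ^ 3 := by
    have h2 : g K j ^ 2 ≤ γ ^ 2 := pow_le_pow_left₀ ha.le haγ 2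
    calc g K j ^ 2 * g (K + 1) (j + 1) ≤ γ ^ 2 * γ := mul_le_mul h2 hbγ hb.le (sq_nonneg γ)
      _ = γ ^ 3 := by ring
  calc |g K j - g (K + 1) (j + 1)|
      ≤ g K j ^ 2 * g (K + 1) (j + 1) * |1 / g K j ^ 2 - 1 / g (K + 1) (j + 1) ^ 2| := h1
    _ ≤ γ ^ 3 * (Cd * θ ^ j) := mul_le_mul hw hd (abs_nonneg _) (pow_nonneg hγ 3)
    _ = γ ^ 3 * Cd * θ ^ j := by ring

/-- The same in the two-sequence form §4 consumes: run A's re-indexed sequence at cutoff `K` is `g K`, run B's (cutoff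
`K+1`, one extra finest coupling dropped) is `fun i => g (K+1) (i+1)`. [folklore] -/
theorem couplingRate_pair_of_injectedDisc {Cd θ γ : ℝ} {g : ℕ → ℕ → ℝ}
    (h : InjectedRate Cd 0 θ (fun K j => T4CouplingMatching.disc (g K) (g (K + 1)) j))
    (hbox : ∀ K i, i ≤ K → 0 < g K i ∧ g K i ≤ γ) (K i : ℕ) (hi : i ≤ K) :
    |g K i - (fun n => g (K + 1) (n + 1)) i| ≤ γ ^ 3 * Cd * θ ^ i :=
  couplingRate_of_injectedDisc h hbox hi

/-! ## §3 The argument bracket AT RATE (node U1b/NE3 ⊛ Lipschitz-in-the-background) -/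

/-- HYPOTHESIS SHAPE (NOT PRINTED) — POLYNOMIAL GROWTH OF THE LIPSCHITZ-IN-U CONSTANT IN THE REMAINING SCALES: at cutoff
`K`, the constant `CU (g^A_K) j` of `T4OutputRate.LipBackground` for domains of scale `j ≤ K` is at most
`P·(K − j + 1)^q`.  Printed reason such growth is to be expected and no worse: the analyticity domains shrink like
`α_{·,j} = g_jC(log g_j^{−2})^q` ((2.28) p. 259 of [Balaban1988Convergent]) and `1/g_j²` grows at most LINEARLY in the
number of remaining steps `K − j` ((0.31) p. 258 of [Balaban1987RG1], upper half).  A Cauchy estimate on a shrunk domain is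
NOT carried out anywhere in the tree (cell GAPS G-t4-U3-2). [cite: Balaban1988Convergent, (2.27)-(2.28) p.259] -/
def PolyLipGrowth (CU : (ℕ → ℝ) → ℕ → ℝ) (gA : ℕ → ℕ → ℝ) (P : ℝ) (q : ℕ) : Prop :=
  ∀ K j, j ≤ K → 0 ≤ CU (gA K) j ∧ CU (gA K) j ≤ P * (((K - j : ℕ) : ℝ) + 1) ^ q

/-- **ARGUMENT BRACKET AT RATE, ONE CUTOFF.**  A Lipschitz constant `≤ P(K−j+1)^q` times a closeness `δK ≤ C₃θ₃^K` of the
two runs' final backgrounds (`K` = number of steps; node U1b in consumer shape) is `≤ P·C₃·M·θ^j` for every `θ ≥ θ₃`, where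
`M` bounds `(n+1)^qθ₃^n` (`exists_bound_succ_pow_mul_pow`): the factor `θ₃^{K−j}` pays for the growth, the constant does
not depend on `K`.  This is the `ha` input of `T4OutputRate.u3_geometric`. [folklore] -/
theorem argBracket_of_polyGrowth {P C₃ θ₃ θ M : ℝ} {q : ℕ} (hP : 0 ≤ P) (hC₃ : 0 ≤ C₃) (hθ₃ : 0 ≤ θ₃)
    (hθ₃θ : θ₃ ≤ θ) (hM : ∀ n : ℕ, ((n : ℝ) + 1) ^ q * θ₃ ^ n ≤ M) {K : ℕ} {CUK : ℕ → ℝ} {δK : ℝ}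
    (hCU : ∀ j ≤ K, CUK j ≤ P * (((K - j : ℕ) : ℝ) + 1) ^ q) (hδ0 : 0 ≤ δK) (hδ : δK ≤ C₃ * θ₃ ^ K)
    {j : ℕ} (hj : j ≤ K) : CUK j * δK ≤ P * C₃ * M * θ ^ j := by
  have hn : θ₃ ^ K = θ₃ ^ (K - j) * θ₃ ^ j := by rw [← pow_add, Nat.sub_add_cancel hj]
  have hPC : 0 ≤ P * C₃ := mul_nonneg hP hC₃
  have hM0 : 0 ≤ M := by
    have h0 := hM 0
    simp only [Nat.cast_zero, zero_add, one_pow, pow_zero, mul_one] at h0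
    linarith
  calc CUK j * δK ≤ (P * (((K - j : ℕ) : ℝ) + 1) ^ q) * (C₃ * θ₃ ^ K) :=
        mul_le_mul (hCU j hj) hδ hδ0 (mul_nonneg hP (by positivity))
    _ = P * C₃ * ((((K - j : ℕ) : ℝ) + 1) ^ q * θ₃ ^ (K - j)) * θ₃ ^ j := by rw [hn]; ring
    _ ≤ P * C₃ * M * θ₃ ^ j :=
        mul_le_mul_of_nonneg_right (mul_le_mul_of_nonneg_left (hM (K - j)) hPC) (pow_nonneg hθ₃ j)
    _ ≤ P * C₃ * M * θ ^ j :=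
        mul_le_mul_of_nonneg_left (pow_le_pow_left₀ hθ₃ hθ₃θ j) (mul_nonneg hPC hM0)

/-- **ARGUMENT BRACKET AT RATE, ALONG THE TOWER.**  Under `PolyLipGrowth CU gA P q` and closeness `0 ≤ δc K ≤ C₃θ₃^K` for
every cutoff, with `θ₃ ≤ θ`, `θ₃ < 1`: ONE constant `a` serves all `K` and all scales `j ≤ K`. [folklore] -/
theorem argBracket_tower {CU : (ℕ → ℝ) → ℕ → ℝ} {gA : ℕ → ℕ → ℝ} {P C₃ θ₃ θ : ℝ} {q : ℕ} {δc : ℕ → ℝ}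
    (hG : PolyLipGrowth CU gA P q) (hP : 0 ≤ P) (hC₃ : 0 ≤ C₃) (hθ₃ : 0 ≤ θ₃) (hθ₃1 : θ₃ < 1) (hθ₃θ : θ₃ ≤ θ)
    (hδ0 : ∀ K, 0 ≤ δc K) (hδ : ∀ K, δc K ≤ C₃ * θ₃ ^ K) :
    ∃ a : ℝ, 0 ≤ a ∧ ∀ K j, j ≤ K → CU (gA K) j * δc K ≤ a * θ ^ j := by
  obtain ⟨M, hM0, hM⟩ := exists_bound_succ_pow_mul_pow hθ₃ hθ₃1 q
  refine ⟨P * C₃ * M, mul_nonneg (mul_nonneg hP hC₃) hM0, fun K j hj => ?_⟩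
  exact argBracket_of_polyGrowth hP hC₃ hθ₃ hθ₃θ hM (fun j hj => (hG K j hj).2) (hδ0 K) (hδ K) hj

/-! ## §4 The three brackets composed along the tower (node U3 up to cutoff `K`, uniform constants) -/

section Tower

variable {C : Carriers} {V : Type*}

/-- CONSUMER SHAPE of node U3 ALONG THE V-FAMILY UP TO CUTOFF `K` (NOT PRINTED): `T4RecentScale.URate` restricted to the
domains of scale `≤ K` — the ones a cutoff-`K` ledger contains (node U2's coupling rate and the Lipschitz growth are only
available for `j ≤ K`).  A CELL SHAPE with no printed counterpart: [Balaban1987RG1] Thm 1 p. 259 (the small-field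
representation theorem on `]0, γ]`, cell register `t4/CITED-FACTS-T4.md` F-T4-13) is only the reason the run's data exist for
`j ≤ K` — it prints no rate and no two-run object (DOCFIX v1.1 after the register's advisory, CLAIMS.log 2026-08-19T07:39:56Z).
[folklore] (a definition; cell shape, NOT PRINTED) -/
def URateUpTo (K : ℕ) (EA : Functional C C.BgA) (EB : Functional C C.BgB) (gA gB : ℕ → ℝ) (uA : V → C.BgA)
    (uB : V → C.BgB) (Adm : Set V) (E₀' θ κ : ℝ) : Prop :=
  ∀ v ∈ Adm, ∀ X : C.Dom, C.scale X ≤ K →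
    |EA gA (uA v) X - EB gB (uB v) X| ≤ E₀' * θ ^ C.scale X * Real.exp (-(κ * C.d X))

/-- The unrestricted shape implies the restricted one. [folklore] -/
theorem uRateUpTo_of_uRate {EA : Functional C C.BgA} {EB : Functional C C.BgB} {gA gB : ℕ → ℝ} {uA : V → C.BgA}
    {uB : V → C.BgB} {Adm : Set V} {E₀' θ κ : ℝ} (h : URate EA EB gA gB uA uB Adm E₀' θ κ) (K : ℕ) :
    URateUpTo K EA EB gA gB uA uB Adm E₀' θ κ :=
  fun v hv X _ => h v hv X

/-- Node U3's three brackets up to cutoff `K`: `T4OutputRate.u3_geometric` at every admissible `v` and every domain of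
scale `≤ K`, with bracket hypotheses only for scales `≤ K`. [folklore] -/
theorem uRateUpTo_of_brackets {W : Set (ℕ → ℝ)} {EA : Functional C C.BgA} {EB : Functional C C.BgB} {κ θ C₅ : ℝ}
    {Λ : ℕ → ℕ → ℝ} {CU : (ℕ → ℝ) → ℕ → ℝ} (h9 : NE9 EA W κ Λ) (hU : LipBackground EA W κ CU)
    (h5 : NE5 EA EB W κ θ C₅) {gA gB : ℕ → ℝ} (hgA : gA ∈ W) (hgB : gB ∈ W) {uA : V → C.BgA} {uB : V → C.BgB}
    {Adm : Set V} {δ : ℝ} (hclose : ∀ v ∈ Adm, C.gauge (uA v) (C.transport (uB v)) ≤ δ) {K : ℕ}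
    (hCU : ∀ j ≤ K, 0 ≤ CU gA j) {a b : ℝ} (ha : ∀ j ≤ K, CU gA j * δ ≤ a * θ ^ j)
    (hb : ∀ j ≤ K, (∑ i ∈ range j, Λ j i * |gA i - gB i|) ≤ b * θ ^ j) :
    URateUpTo K EA EB gA gB uA uB Adm (a + b + C₅) θ κ :=
  fun v hv X hX => u3_geometric h9 hU h5 hgA hgB (hclose v hv) X (hCU _ hX) (ha _ hX) (hb _ hX)

/-- **NODE U3 ALONG THE TOWER, SEPARATED RATES (the term-wise composition).**  NE9 + fading memory (`ω`) + Lipschitz-in-U +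
NE5 (`θ`) on a window `W` containing both runs' re-indexed sequences at every cutoff, node U2's coupling rate
`|g^A_{K,i} − g^B_{K,i}| ≤ Dθ^i` (`i ≤ K`), the closeness `δc K` of the backgrounds and the composed argument bracket
`CU·δc K ≤ aθ^j` (§3) give, FOR EVERY CUTOFF `K`, the node-U3 rate on all domains of scale `≤ K` with the SAME constant
`a + C₉Dω/(θ−ω) + C₅` when `ω < θ`.  Uniformity in `K` of this constant is what makes the rate branch of the crossover
`K`-independent (§5–§6). [folklore] -/
theorem uRateUpTo_tower {W : Set (ℕ → ℝ)} {EA : Functional C C.BgA} {EB : Functional C C.BgB}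
    {κ θ C₅ C₉ ω D a : ℝ} {Λ : ℕ → ℕ → ℝ} {CU : (ℕ → ℝ) → ℕ → ℝ} (h9 : NE9 EA W κ Λ) (hΛ : FadingMemory C₉ ω Λ)
    (hU : LipBackground EA W κ CU) (h5 : NE5 EA EB W κ θ C₅) (hω : 0 ≤ ω) (hωθ : ω < θ) (hD : 0 ≤ D)
    {gA gB : ℕ → ℕ → ℝ} (hgA : ∀ K, gA K ∈ W) (hgB : ∀ K, gB K ∈ W)
    (hcoup : ∀ K i, i ≤ K → |gA K i - gB K i| ≤ D * θ ^ i)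
    {uA : ℕ → V → C.BgA} {uB : ℕ → V → C.BgB} {Adm : ℕ → Set V} {δc : ℕ → ℝ}
    (hclose : ∀ K, ∀ v ∈ Adm K, C.gauge (uA K v) (C.transport (uB K v)) ≤ δc K)
    (hCU : ∀ K j, j ≤ K → 0 ≤ CU (gA K) j) (harg : ∀ K j, j ≤ K → CU (gA K) j * δc K ≤ a * θ ^ j) (K : ℕ) :
    URateUpTo K EA EB (gA K) (gB K) (uA K) (uB K) (Adm K) (a + C₉ * D * (ω / (θ - ω)) + C₅) θ κ :=
  uRateUpTo_of_brackets h9 hU h5 (hgA K) (hgB K) (hclose K) (hCU K) (harg K)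
    fun j hj => historySum_le_rate hΛ hω hωθ hD fun i hi => hcoup K i (by omega)

/-- NODE U3 ALONG THE TOWER, EQUAL RATES: if only `ω ≤ θ` is available the constant grows LINEARLY in the cutoff,
`a + C₉D(K+1) + C₅` — harmless for summability by §5 (`summable_crossoverDeltaPoly` with `p = 1`). [folklore] -/
theorem uRateUpTo_tower_linear {W : Set (ℕ → ℝ)} {EA : Functional C C.BgA} {EB : Functional C C.BgB}
    {κ θ C₅ C₉ ω D a : ℝ} {Λ : ℕ → ℕ → ℝ} {CU : (ℕ → ℝ) → ℕ → ℝ} (h9 : NE9 EA W κ Λ) (hΛ : FadingMemory C₉ ω Λ)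
    (hU : LipBackground EA W κ CU) (h5 : NE5 EA EB W κ θ C₅) (hω : 0 ≤ ω) (hωθ : ω ≤ θ) (hD : 0 ≤ D)
    {gA gB : ℕ → ℕ → ℝ} (hgA : ∀ K, gA K ∈ W) (hgB : ∀ K, gB K ∈ W)
    (hcoup : ∀ K i, i ≤ K → |gA K i - gB K i| ≤ D * θ ^ i)
    {uA : ℕ → V → C.BgA} {uB : ℕ → V → C.BgB} {Adm : ℕ → Set V} {δc : ℕ → ℝ}
    (hclose : ∀ K, ∀ v ∈ Adm K, C.gauge (uA K v) (C.transport (uB K v)) ≤ δc K)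
    (hCU : ∀ K j, j ≤ K → 0 ≤ CU (gA K) j) (harg : ∀ K j, j ≤ K → CU (gA K) j * δc K ≤ a * θ ^ j) (K : ℕ) :
    URateUpTo K EA EB (gA K) (gB K) (uA K) (uB K) (Adm K) (a + C₉ * D * ((K : ℝ) + 1) + C₅) θ κ := by
  refine uRateUpTo_of_brackets h9 hU h5 (hgA K) (hgB K) (hclose K) (hCU K) (harg K) fun j hj => ?_
  have h := historySum_le_maxRate hΛ hω (hω.trans hωθ) hD (gA := gA K) (gB := gB K) (j := j)
    fun i hi => hcoup K i (by omega)
  rw [max_eq_right hωθ] at h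
  have hC9D := mul_nonneg (fadingMemory_const_nonneg hΛ) hD
  have hjK : (j : ℝ) ≤ (K : ℝ) + 1 := by exact_mod_cast (by omega : j ≤ K + 1)
  calc ∑ i ∈ range j, Λ j i * |gA K i - gB K i| ≤ C₉ * D * (j : ℝ) * θ ^ j := h
    _ ≤ C₉ * D * ((K : ℝ) + 1) * θ ^ j :=
        mul_le_mul_of_nonneg_right (mul_le_mul_of_nonneg_left hjK hC9D) (pow_nonneg (hω.trans hωθ) j)

/-- **THE FIELD-INDEPENDENT CONSTANTS ARE RATE-SMALL.**  At the trivial backgrounds — run B's `1_B` transported onto run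
A's `1_A` — only the coupling bracket and the functional bracket of node U3 remain: `|E^B(X; g^B, 1_B) − E^A(X; g^A, 1_A)|
≤ (b + C₅)θ^j e^{−κd(X)}`.  These differences are exactly the constants `c_X` of `T4RecentScale.factorLogRatio_smallFieldE`;
their rate-smallness is the per-domain input of the deviation clause (hazard H-U5b-1, `T4GoodClassBudget.RecentDeviation`),
whose volume bookkeeping is NOT done here. [folklore] -/
theorem abs_const_sub_le {W : Set (ℕ → ℝ)} {EA : Functional C C.BgA} {EB : Functional C C.BgB} {κ θ C₅ : ℝ}
    {Λ : ℕ → ℕ → ℝ} (h9 : NE9 EA W κ Λ) (h5 : NE5 EA EB W κ θ C₅) {gA gB : ℕ → ℝ} (hgA : gA ∈ W) (hgB : gB ∈ W)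
    {oneA : C.BgA} {oneB : C.BgB} (hone : C.transport oneB = oneA) (X : C.Dom) {b : ℝ}
    (hb : (∑ i ∈ range (C.scale X), Λ (C.scale X) i * |gA i - gB i|) ≤ b * θ ^ C.scale X) :
    |EB gB oneB X - EA gA oneA X| ≤ (b + C₅) * θ ^ C.scale X * Real.exp (-(κ * C.d X)) := by
  have h1 := h9 gA hgA gB hgB oneA X
  have h2 := h5 gB hgB oneB X
  rw [hone] at h2
  have he : 0 ≤ Real.exp (-(κ * C.d X)) := (Real.exp_pos _).le
  have htri : |EB gB oneB X - EA gA oneA X| ≤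
      |EA gA oneA X - EA gB oneA X| + |EA gB oneA X - EB gB oneB X| := by
    rw [abs_sub_comm]
    exact abs_sub_le _ _ _
  calc |EB gB oneB X - EA gA oneA X|
      ≤ Real.exp (-(κ * C.d X)) * (∑ i ∈ range (C.scale X), Λ (C.scale X) i * |gA i - gB i|)
          + C₅ * θ ^ C.scale X * Real.exp (-(κ * C.d X)) := htri.trans (add_le_add h1 h2)
    _ ≤ Real.exp (-(κ * C.d X)) * (b * θ ^ C.scale X) + C₅ * θ ^ C.scale X * Real.exp (-(κ * C.d X)) :=
        add_le_add (mul_le_mul_of_nonneg_left hb he) le_rfl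
    _ = (b + C₅) * θ ^ C.scale X * Real.exp (-(κ * C.d X)) := by ring

/-- **THE NODE-U5b INSTANCE FOR `Kind.smallFieldE` ON A CUTOFF-`K` LEDGER**: `T4RecentScale.factorLogRatio_smallFieldE`
verbatim, from the restricted shape `URateUpTo K`, for ledgers all of whose domains have scale `≤ K`. [folklore] -/
theorem factorLogRatio_smallFieldE_upTo {EA : Functional C C.BgA} {EB : Functional C C.BgB} {gA gB : ℕ → ℝ}
    {uA : V → C.BgA} {uB : V → C.BgB} {Adm : Set V} {E₀' θ κ : ℝ} {K : ℕ}
    (h : URateUpTo K EA EB gA gB uA uB Adm E₀' θ κ) (oneA : C.BgA) (oneB : C.BgB) (fac : Finset C.Dom)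
    (hfac : ∀ X ∈ fac, C.scale X ≤ K) (Ck : Kind → ℝ) (hCk : Ck Kind.smallFieldE = E₀') :
    FactorLogRatio Adm fac (fun _ => Kind.smallFieldE) C.scale (fun X => Real.exp (-(κ * C.d X)))
      (fun X v => Real.exp (EA gA (uA v) X - EA gA oneA X)) (fun X v => Real.exp (EB gB (uB v) X - EB gB oneB X))
      (fun X => -(EB gB oneB X - EA gA oneA X)) Ck θ (fun _ => 0) := by
  intro v hv X hX
  refine ⟨Real.exp_pos _, Real.exp_pos _, ?_⟩
  rw [Real.log_exp, Real.log_exp, recentProfile, hCk, add_zero]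
  have e : EB gB (uB v) X - EB gB oneB X - (EA gA (uA v) X - EA gA oneA X) - -(EB gB oneB X - EA gA oneA X)
      = -(EA gA (uA v) X - EB gB (uB v) X) := by ring
  rw [e, abs_neg]
  exact h v hv X (hfac X hX)

end Tower

/-! ## §5 Summability with polynomially growing rate constants -/

/-- THE CROSSOVER MAJORANT WITH A POLYNOMIAL RATE CONSTANT: `T4Crossover.crossoverDelta` at cutoff `K` with rate constant
`C·(K+1)^p` (and E-branch constant `E + C(K+1)^p`, which dominates both the size constant `E` and the rate constant),
`crossoverDeltaPoly … K = (E + C(K+1)^p)·Σ_{j+n=K} min(a^n, θ^jΛ^n) + Σ_{j+n=K} min(R₁ g_{K,j}^{κ₀}, C(K+1)^p θ^jΛ^n) + w K`.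
[folklore] (a definition; abstract sizes, nothing of Bałaban's is asserted) -/
noncomputable def crossoverDeltaPoly (E a θ Λ R₁ C : ℝ) (p κ₀ : ℕ) (gs : ℕ → ℕ → ℝ) (w : ℕ → ℝ) (K : ℕ) : ℝ :=
  (E + C * ((K : ℝ) + 1) ^ p) * (∑ x ∈ antidiagonal K, min (a ^ x.2) (θ ^ x.1 * Λ ^ x.2))
    + (∑ x ∈ antidiagonal K, min (R₁ * gs K x.1 ^ κ₀) (C * ((K : ℝ) + 1) ^ p * θ ^ x.1 * Λ ^ x.2)) + w K

/-- It IS the crossover majorant with `K`-dependent constants. [folklore] -/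
theorem crossoverDeltaPoly_eq (E a θ Λ R₁ C : ℝ) (p κ₀ : ℕ) (gs : ℕ → ℕ → ℝ) (w : ℕ → ℝ) (K : ℕ) :
    crossoverDeltaPoly E a θ Λ R₁ C p κ₀ gs w K =
      crossoverDelta (E + C * ((K : ℝ) + 1) ^ p) a θ Λ R₁ (C * ((K : ℝ) + 1) ^ p) κ₀ gs w K := rfl

/-- E-BRANCH with a polynomial constant: `K ↦ (E + C(K+1)^p)·Σ_{j+n=K} min(a^n, θ^jΛ^n)` is summable for `0 < a < 1`,
`0 < θ < 1`, `θ ≤ Λ`, `E, C ≥ 0` (comparison with `(K+1)^{p+1} q^K`, `q = θ^σ < 1` the crossover rate). [folklore] -/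
theorem summable_eBranch_poly {E C a θ Λ : ℝ} {p : ℕ} (hE : 0 ≤ E) (hC : 0 ≤ C) (ha0 : 0 < a) (ha1 : a < 1)
    (hθ : 0 < θ) (hθ1 : θ < 1) (hθΛ : θ ≤ Λ) :
    Summable (fun K : ℕ =>
      (E + C * ((K : ℝ) + 1) ^ p) * ∑ x ∈ antidiagonal K, min (a ^ x.2) (θ ^ x.1 * Λ ^ x.2)) := by
  set q := θ ^ (Real.log (1 / a) / (Real.log (Λ / θ) + Real.log (1 / a))) with hq
  have hq0 : 0 ≤ q := Real.rpow_nonneg hθ.le _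
  have hq1 : q < 1 := crossoverRate_lt_one ha0 ha1 hθ hθ1 hθΛ
  have h1 := (summable_succ_pow_mul_geometric hq0 hq1 1).mul_left E
  have h2 := (summable_succ_pow_mul_geometric hq0 hq1 (p + 1)).mul_left C
  have hbound : Summable (fun K : ℕ => (E + C * ((K : ℝ) + 1) ^ p) * (((K : ℝ) + 1) * q ^ K)) := by
    refine (h1.add h2).congr fun K => ?_
    rw [pow_one, pow_succ]
    ring
  refine Summable.of_nonneg_of_le (fun K => ?_) (fun K => ?_) hbound
  · exact mul_nonneg (add_nonneg hE (mul_nonneg hC (by positivity))) (Finset.sum_nonneg fun x _ =>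
      le_min (pow_nonneg ha0.le _) (mul_nonneg (pow_nonneg hθ.le _) (pow_nonneg (hθ.le.trans hθΛ) _)))
  · exact mul_le_mul_of_nonneg_left (sum_min_pow_le_crossover ha0 ha1 hθ hθΛ K)
      (add_nonneg hE (mul_nonneg hC (by positivity)))

/-- R-BRANCH with a polynomial constant: `K ↦ Σ_{j+n=K} min(R₁ g_{K,j}^{κ₀}, C(K+1)^p θ^jΛ^n)` is summable under the
hypotheses of `T4Crossover.summable_sum_min_coupling` (the polynomial only multiplies the geometric recent part of
`T4Crossover.min_coupling_le`; the old part is paid by the coupling size, `κ₀ > 4` unchanged). [folklore] -/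
theorem summable_sum_min_coupling_poly {b β' R₁ C θ Λ σ : ℝ} {g : ℕ → ℝ} {gs : ℕ → ℕ → ℝ} {κ₀ p : ℕ} (hb : 0 < b)
    (h031 : ∀ K, Step.Discrete031 b β' K (g K) (gs K)) (hpos : ∀ K k, k ≤ K → 0 ≤ gs K k) (hR₁ : 0 ≤ R₁)
    (hC : 0 ≤ C) (hθ : 0 < θ) (hθΛ : θ ≤ Λ) (hσ : 0 < σ) (hq : θ * (Λ / θ) ^ σ < 1) (hκ : 4 < κ₀) :
    Summable (fun K : ℕ => ∑ x ∈ antidiagonal K,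
      min (R₁ * gs K x.1 ^ κ₀) (C * ((K : ℝ) + 1) ^ p * θ ^ x.1 * Λ ^ x.2)) := by
  have hr0 : 0 < Λ / θ := div_pos (hθ.trans_le hθΛ) hθ
  have hq0 : 0 ≤ θ * (Λ / θ) ^ σ := mul_nonneg hθ.le (Real.rpow_nonneg hr0.le _)
  have hκ' : (2 : ℝ) < (κ₀ : ℝ) / 2 := by
    have : (4 : ℝ) < κ₀ := by exact_mod_cast hκ
    linarith
  have hA := (summable_succ_mul_inv_rpow (mul_pos hb hσ) hκ').mul_left R₁
  have hB := (summable_succ_pow_mul_geometric hq0 hq (p + 1)).mul_left (C * (Λ / θ) ^ σ)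
  have hbound : Summable (fun K : ℕ => ((K : ℝ) + 1) *
      (R₁ * (b * σ * ((K : ℝ) + 1))⁻¹ ^ ((κ₀ : ℝ) / 2)
        + C * ((K : ℝ) + 1) ^ p * (Λ / θ) ^ σ * (θ * (Λ / θ) ^ σ) ^ K)) := by
    refine (hA.add hB).congr fun K => ?_
    rw [pow_succ]
    ring
  refine Summable.of_nonneg_of_le (fun K => Finset.sum_nonneg fun x hx => ?_) (fun K => ?_) hbound
  · have hj : x.1 ≤ K := by have := mem_antidiagonal.mp hx; omega
    exact le_min (mul_nonneg hR₁ (pow_nonneg (hpos K x.1 hj) _))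
      (mul_nonneg (mul_nonneg (mul_nonneg hC (by positivity)) (pow_nonneg hθ.le _))
        (pow_nonneg (hθ.le.trans hθΛ) _))
  · exact sum_min_coupling_le hb (h031 K) (hpos K) hR₁ (mul_nonneg hC (by positivity)) hθ hθΛ hσ

/-- **`Summable (crossoverDeltaPoly …)`** under the hypotheses of `T4Crossover.summable_crossoverDelta` plus `0 ≤ E`:
polynomial growth of the rate constants in the cutoff does not endanger `Σ_K δ_K < ∞`. [folklore] -/
theorem summable_crossoverDeltaPoly {E a θ Λ b β' R₁ C : ℝ} {p κ₀ : ℕ} {g : ℕ → ℝ} {gs : ℕ → ℕ → ℝ} {w : ℕ → ℝ}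
    (hE : 0 ≤ E) (hC : 0 ≤ C) (ha0 : 0 < a) (ha1 : a < 1) (hθ : 0 < θ) (hθ1 : θ < 1) (hθΛ : θ ≤ Λ) (hb : 0 < b)
    (h031 : ∀ K, Step.Discrete031 b β' K (g K) (gs K)) (hpos : ∀ K k, k ≤ K → 0 ≤ gs K k) (hR₁ : 0 ≤ R₁)
    (hκ : 4 < κ₀) (hw : Summable w) :
    Summable (crossoverDeltaPoly E a θ Λ R₁ C p κ₀ gs w) := by
  obtain ⟨σ, hσ, hq⟩ := exists_recentRate_lt_one hθ hθ1 hθΛ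
  have h := ((summable_eBranch_poly hE hC ha0 ha1 hθ hθ1 hθΛ (p := p)).add
    (summable_sum_min_coupling_poly hb h031 hpos hR₁ hC hθ hθΛ hσ hq hκ (p := p))).add hw
  exact h.congr fun K => rfl

/-! ## §6 The plug: slice radii ⇒ per-term radius ⇒ `TermBudget` ⇒ `GoodClause` with `Summable δ` -/

/-- THE RATE RADIUS OF A SLICE: under multiplicity (`T4RecentScale.Multiplicity`, NOT PRINTED for a two-run ledger) the
scale-`j` slice of a per-factor RATE profile `Cr·θ^{sc i}·w_i` totals at most `Cw·vol·(Cr θ^j Λ^{K−j})` — the `hρ` input of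
`T4GoodClassBudget.sum_min_le_crossoverShape` (`Cr` may be the cutoff-dependent constant `C(K+1)^p` of §4–§5). [folklore] -/
theorem rateSlice_le {ι : Type*} {fac : Finset ι} {sc : ι → ℕ} {w : ι → ℝ} {Cw vol Λ Cr θ : ℝ} {K : ℕ}
    (hM : Multiplicity fac sc w Cw vol Λ K) (hCr : 0 ≤ Cr) (hθ : 0 ≤ θ) {j : ℕ} (hj : j ≤ K) :
    ∑ i ∈ fac with sc i = j, Cr * θ ^ sc i * w i ≤ Cw * vol * (Cr * θ ^ j * Λ ^ (K - j)) := by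
  have e : ∑ i ∈ fac with sc i = j, Cr * θ ^ sc i * w i = Cr * θ ^ j * ∑ i ∈ fac with sc i = j, w i := by
    rw [mul_sum]
    refine sum_congr rfl fun i hi => ?_
    rw [(mem_filter.mp hi).2]
  rw [e]
  calc Cr * θ ^ j * ∑ i ∈ fac with sc i = j, w i ≤ Cr * θ ^ j * (Cw * vol * Λ ^ (K - j)) :=
        mul_le_mul_of_nonneg_left (hM j hj) (mul_nonneg hCr (pow_nonneg hθ j))
    _ = Cw * vol * (Cr * θ ^ j * Λ ^ (K - j)) := by ring

/-- **PER-TERM RADIUS ≤ `vol·max(Cw,1)·crossoverDeltaPoly … K`.**  Per-slice SIZE radii of the printed all-regular shapes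
— E-kind `≤ vol·E·a^{K−j}` ((2.43) with `n = k`, `a = L^{−β}`), R-kind `≤ vol·R₁ g_{K,j}^{κ₀}` ((2.44) with `n = k`) — and
RATE radii `≤ Cw·vol·(C(K+1)^p θ^j Λ^{K−j})` for both kinds (`rateSlice_le` with the composed rate of §4), plus a budget `RO`
for the remaining kinds against the slot `w`, give the per-term radius of `T4GoodClassBudget.TermBudget.remainder` with
`r K = max(Cw,1)·crossoverDeltaPoly … K`.  The minimum per slice is `T4GoodClassBudget.slice_le_min`'s; the large-field
volume parts `n < k` of (2.43)/(2.44) are NOT in these size radii (record §R2 of `t4/T4-EST-U5E-b.md`). [folklore] -/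
theorem termRadius_le_crossoverDeltaPoly {SE ρE SR ρR : ℕ → ℝ} {RO vol Cw E a θ Λ R₁ C : ℝ} {p κ₀ K : ℕ}
    {gs : ℕ → ℕ → ℝ} {w : ℕ → ℝ} (hvol : 0 ≤ vol) (hE : 0 ≤ E) (ha : 0 ≤ a) (hθ : 0 ≤ θ)
    (hΛ : 0 ≤ Λ) (hR₁ : 0 ≤ R₁) (hC : 0 ≤ C) (hgs : ∀ j ≤ K, 0 ≤ gs K j)
    (hSE : ∀ j ≤ K, SE j ≤ vol * (E * a ^ (K - j)))
    (hρE : ∀ j ≤ K, ρE j ≤ Cw * vol * (C * ((K : ℝ) + 1) ^ p * θ ^ j * Λ ^ (K - j)))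
    (hSR : ∀ j ≤ K, SR j ≤ vol * (R₁ * gs K j ^ κ₀))
    (hρR : ∀ j ≤ K, ρR j ≤ Cw * vol * (C * ((K : ℝ) + 1) ^ p * θ ^ j * Λ ^ (K - j)))
    (hO : RO ≤ vol * max Cw 1 * w K) :
    (∑ j ∈ range (K + 1), min (SE j) (ρE j)) + (∑ j ∈ range (K + 1), min (SR j) (ρR j)) + RO
      ≤ vol * max Cw 1 * crossoverDeltaPoly E a θ Λ R₁ C p κ₀ gs w K := by
  set Cv := vol * max Cw 1 with hCv
  have h1v : vol ≤ Cv :=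
    calc vol = vol * 1 := (mul_one _).symm
      _ ≤ vol * max Cw 1 := mul_le_mul_of_nonneg_left (le_max_right _ _) hvol
  have hCwv : Cw * vol ≤ Cv := by
    rw [hCv, mul_comm Cw]
    exact mul_le_mul_of_nonneg_left (le_max_left _ _) hvol
  have hCv0 : 0 ≤ Cv := mul_nonneg hvol (zero_le_one.trans (le_max_right _ _))
  have hCK0 : 0 ≤ C * ((K : ℝ) + 1) ^ p := mul_nonneg hC (by positivity)
  have hrate0 : ∀ j, 0 ≤ C * ((K : ℝ) + 1) ^ p * θ ^ j * Λ ^ (K - j) := fun j =>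
    mul_nonneg (mul_nonneg hCK0 (pow_nonneg hθ _)) (pow_nonneg hΛ _)
  -- E-branch
  have hSE' : ∀ j ≤ K, SE j ≤ Cv * (E * a ^ (K - j)) := fun j hj =>
    (hSE j hj).trans (mul_le_mul_of_nonneg_right h1v (mul_nonneg hE (pow_nonneg ha _)))
  have hρE' : ∀ j ≤ K, ρE j ≤ Cv * (C * ((K : ℝ) + 1) ^ p * θ ^ j * Λ ^ (K - j)) := fun j hj =>
    (hρE j hj).trans (mul_le_mul_of_nonneg_right hCwv (hrate0 j))
  have hEsum := sum_min_le_crossoverShape (SZ := fun j => E * a ^ (K - j)) hSE' hρE'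
  have hEbr : ∑ x ∈ antidiagonal K, min (E * a ^ (K - x.1)) (C * ((K : ℝ) + 1) ^ p * θ ^ x.1 * Λ ^ x.2)
      ≤ (E + C * ((K : ℝ) + 1) ^ p) * ∑ x ∈ antidiagonal K, min (a ^ x.2) (θ ^ x.1 * Λ ^ x.2) := by
    refine sum_min_le_eBranch (SZ := fun j => E * a ^ (K - j)) (add_nonneg hE hCK0) hθ hΛ (by linarith)
      fun x hx => ?_
    have hx' : K - x.1 = x.2 := by have := mem_antidiagonal.mp hx; omega
    show E * a ^ (K - x.1) ≤ (E + C * ((K : ℝ) + 1) ^ p) * a ^ x.2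
    rw [hx']
    exact mul_le_mul_of_nonneg_right (by linarith) (pow_nonneg ha _)
  -- R-branch
  have hSR' : ∀ j ≤ K, SR j ≤ Cv * (R₁ * gs K j ^ κ₀) := fun j hj =>
    (hSR j hj).trans (mul_le_mul_of_nonneg_right h1v (mul_nonneg hR₁ (pow_nonneg (hgs j hj) _)))
  have hρR' : ∀ j ≤ K, ρR j ≤ Cv * (C * ((K : ℝ) + 1) ^ p * θ ^ j * Λ ^ (K - j)) := fun j hj =>
    (hρR j hj).trans (mul_le_mul_of_nonneg_right hCwv (hrate0 j))
  have hRsum := sum_min_le_crossoverShape (SZ := fun j => R₁ * gs K j ^ κ₀) hSR' hρR'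
  have key := le_mul_crossoverDelta (hEsum.trans (mul_le_mul_of_nonneg_left hEbr hCv0)) hRsum hO
  exact key

/-- **THE PLUG (row T4-U5.E-b with the term-wise profile): `TermBudget` ⇒ `GoodClause` WITH `Summable δ`.**  A per-term
budget whose remainder profile is `r K = Cv·crossoverDeltaPoly … K` (§5–§6) and whose constant-deviation profile `s` is
summable (hazard H-U5b-1 — a HYPOTHESIS here) gives the good clause with `δ = r + s` AND its summability: both inputs
`hgood`, `hδ` of `T4GoodClassBudget.cauchy_of_goodClause` (whose remaining input, the weight budget `RelWeightBound`, is the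
other half of NE7).  CONDITIONAL on every hypothesis shape named in this module; NE7 itself is NOT PRINTED and NOT proved.
[folklore] -/
theorem goodClause_summable_of_termBudget {ι : Type*} [DecidableEq ι] {l₀ vol : ℝ} {T : ℕ → Finset ι}
    {A B : ℕ → ℝ → ι → ℝ} {Bad : ℕ → ℝ → Finset ι} {Cc Rr : ℕ → ℝ → ι → ℝ} {c₀ s : ℕ → ℝ}
    {Cv E a θ Λ b β' R₁ C : ℝ} {p κ₀ : ℕ} {g : ℕ → ℝ} {gs : ℕ → ℕ → ℝ} {w : ℕ → ℝ}
    (hT : TermBudget l₀ vol T A B Bad Cc Rr c₀ (fun K => Cv * crossoverDeltaPoly E a θ Λ R₁ C p κ₀ gs w K) s)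
    (hE : 0 ≤ E) (hC : 0 ≤ C) (ha0 : 0 < a) (ha1 : a < 1) (hθ : 0 < θ) (hθ1 : θ < 1) (hθΛ : θ ≤ Λ) (hb : 0 < b)
    (h031 : ∀ K, Step.Discrete031 b β' K (g K) (gs K)) (hpos : ∀ K k, k ≤ K → 0 ≤ gs K k) (hR₁ : 0 ≤ R₁)
    (hκ : 4 < κ₀) (hw : Summable w) (hs : Summable s) :
    GoodClause l₀ vol T A B Bad (fun K => Cv * crossoverDeltaPoly E a θ Λ R₁ C p κ₀ gs w K + s K) ∧
      Summable (fun K => Cv * crossoverDeltaPoly E a θ Λ R₁ C p κ₀ gs w K + s K) :=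
  ⟨goodClause_of_termBudget hT,
    ((summable_crossoverDeltaPoly hE hC ha0 ha1 hθ hθ1 hθΛ hb h031 hpos hR₁ hκ hw).mul_left Cv).add hs⟩

/-! ## §7 Non-vacuity: a toy family meeting every hypothesis of `uRateUpTo_tower` with a genuine rate -/

section Toy

/-- TOY CARRIERS (no relation to Bałaban's objects; only to show the hypothesis SET of §4 is jointly satisfiable with a
non-zero rate): domains `ℕ` labelled by their scale, tree length `0`, backgrounds `ℝ` for both runs, gauge `|U − U'|`,
identity transport. [folklore] (a definition) -/
abbrev toyCarriers : Carriers where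
  Dom := ℕ
  scale := fun j => j
  d := fun _ => 0
  d_nonneg := fun _ => le_rfl
  BgA := ℝ
  BgB := ℝ
  gauge := fun U U' => |U - U'|
  gauge_nonneg := fun _ _ => abs_nonneg _
  transport := fun U => U

/-- TOY run-A functional `E^A(j; g, U) = θ^j·U + Σ_{i<j} ω^{j−i} g_i`: the background enters at rate `θ^j`, the coupling
history with fading memory `ω^{j−i}`. [folklore] (a definition) -/
def toyEA (θ ω : ℝ) : Functional toyCarriers toyCarriers.BgA :=
  fun g (U : ℝ) (j : ℕ) => θ ^ j * U + ∑ i ∈ range j, ω ^ (j - i) * g i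

/-- TOY run-B functional: run A's minus `C₅θ^j`. [folklore] (a definition) -/
def toyEB (θ ω C₅ : ℝ) : Functional toyCarriers toyCarriers.BgB :=
  fun g (U : ℝ) (j : ℕ) => θ ^ j * U + ∑ i ∈ range j, ω ^ (j - i) * g i - C₅ * θ ^ j

/-- **NON-VACUITY of §4's hypothesis set.**  For `0 ≤ θ ≤ 1`, `0 ≤ ω`, `0 ≤ C₅` the toy family satisfies NE9 with history
moduli `Λ k i = ω^{k−i}`, their fading memory with `C₉ = 1`, Lipschitz-in-U with `CU ≡ 1`, and NE5 with the rate `θ` and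
constant `C₅`, all on the window `W = univ` with `κ = 0` — and the two toy runs DIFFER by exactly `C₅θ^j`, so the
conclusion of `uRateUpTo_tower` is not vacuous either. [folklore] -/
theorem toy_nonvacuous {θ ω C₅ : ℝ} (hθ0 : 0 ≤ θ) (hθ1 : θ ≤ 1) (hω : 0 ≤ ω) (hC₅ : 0 ≤ C₅) :
    NE9 (toyEA θ ω) Set.univ 0 (fun k i => ω ^ (k - i)) ∧
      FadingMemory 1 ω (fun k i => ω ^ (k - i)) ∧
      LipBackground (toyEA θ ω) Set.univ 0 (fun _ _ => 1) ∧
      NE5 (toyEA θ ω) (toyEB θ ω C₅) Set.univ 0 θ C₅ := by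
  refine ⟨?_, ?_, ?_, ?_⟩
  · intro g _ g' _ (U : ℝ) (X : ℕ)
    show |(θ ^ X * U + ∑ i ∈ range X, ω ^ (X - i) * g i) - (θ ^ X * U + ∑ i ∈ range X, ω ^ (X - i) * g' i)|
      ≤ Real.exp (-(0 * (0 : ℝ))) * ∑ i ∈ range X, ω ^ (X - i) * |g i - g' i|
    rw [mul_zero, neg_zero, Real.exp_zero, one_mul]
    have e : (θ ^ X * U + ∑ i ∈ range X, ω ^ (X - i) * g i) - (θ ^ X * U + ∑ i ∈ range X, ω ^ (X - i) * g' i)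
        = ∑ i ∈ range X, (ω ^ (X - i) * g i - ω ^ (X - i) * g' i) := by
      rw [sum_sub_distrib]; ring
    calc |(θ ^ X * U + ∑ i ∈ range X, ω ^ (X - i) * g i) - (θ ^ X * U + ∑ i ∈ range X, ω ^ (X - i) * g' i)|
        = |∑ i ∈ range X, (ω ^ (X - i) * g i - ω ^ (X - i) * g' i)| := by rw [e]
      _ ≤ ∑ i ∈ range X, |ω ^ (X - i) * g i - ω ^ (X - i) * g' i| := abs_sum_le_sum_abs _ _
      _ = ∑ i ∈ range X, ω ^ (X - i) * |g i - g' i| :=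
          sum_congr rfl fun i _ => by rw [← mul_sub, abs_mul, abs_of_nonneg (pow_nonneg hω _)]
  · exact fun k i _ => ⟨pow_nonneg hω _, by rw [one_mul]⟩
  · intro g _ (U : ℝ) (U' : ℝ) (X : ℕ)
    show |(θ ^ X * U + ∑ i ∈ range X, ω ^ (X - i) * g i) - (θ ^ X * U' + ∑ i ∈ range X, ω ^ (X - i) * g i)|
      ≤ 1 * Real.exp (-(0 * (0 : ℝ))) * |U - U'|
    rw [mul_zero, neg_zero, Real.exp_zero, one_mul, one_mul]
    have e : (θ ^ X * U + ∑ i ∈ range X, ω ^ (X - i) * g i) - (θ ^ X * U' + ∑ i ∈ range X, ω ^ (X - i) * g i)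
        = θ ^ X * (U - U') := by ring
    rw [e, abs_mul, abs_of_nonneg (pow_nonneg hθ0 _)]
    exact mul_le_of_le_one_left (abs_nonneg _) (pow_le_one₀ hθ0 hθ1)
  · intro g _ (U : ℝ) (X : ℕ)
    show |(θ ^ X * U + ∑ i ∈ range X, ω ^ (X - i) * g i)
        - (θ ^ X * U + ∑ i ∈ range X, ω ^ (X - i) * g i - C₅ * θ ^ X)| ≤ C₅ * θ ^ X * Real.exp (-(0 * (0 : ℝ)))
    rw [mul_zero, neg_zero, Real.exp_zero, mul_one]
    have e : (θ ^ X * U + ∑ i ∈ range X, ω ^ (X - i) * g i)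
        - (θ ^ X * U + ∑ i ∈ range X, ω ^ (X - i) * g i - C₅ * θ ^ X) = C₅ * θ ^ X := by ring
    rw [e, abs_of_nonneg (mul_nonneg hC₅ (pow_nonneg hθ0 _))]

end Toy

end Literature.MathematicalPhysics.QuantumFieldTheory.Balaban1983to89.T4TowerRateComposition
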